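import Summits.Ventures.HSemireg.WedgeC15General
import Summits.Ventures.HSemireg.WedgeCarrierGlue
import Summits.Ventures.HSemireg.ContractionSpanKunnethFactors
import HarnessLib

/-!
# Venture HSemireg — K∘T∘H ON THE REAL CARRIERS: `contractionRank` of a BOX of two arbitrary h-part classes
# `κ = v(q₁) ⊠ v(q₂)` — `r = C(n₁,2)ρ₂(q₁)·[v₂ ≠ 0] + n₁ρ₁(q₁)·n₂ρ₁(q₂) + [v₁ ≠ 0]·C(n₂,2)ρ₂(q₂)`

HONEST FRAMING. The end-to-end form of th-7's THEOREM K∘T at degree `2` composed with THEOREM H (`theory/FORMULA-N-th7.md`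
PART A §2.3 / §2.6, PART B §N.3 / §N.5 / §N.9–N.11) on the carriers of `PerfectComplexRankDoor.lean` (seat p4 of the computation
cell `pub-hsemireg`): `ContractionSpanKunnethFactors.contractionRank_box` (p4 gen 2: the Künneth count with INTRINSIC factor data)
with its two independence inputs DISCHARGED by the W-degree theorem of the carrier bridge (`WedgeBridge.iSupIndep_spans_of_injective`,
p3's enclosure `WedgeCarrierGlue.lean`) and its three factor dimensions IDENTIFIED by th-7's Hankel law carried to the bridge
(`WedgeC15.finrank_S_Ecl_eq_hankel`, p3's enclosure `WedgeC15General.lean`): for every pair of coefficient sequences `q₁, q₂`.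
THE SPLITTING AND THE TWO ADAPTED FRAMES ARE INPUTS, STATED BY VALUE exactly as in `ContractionRankPointPairBox.lean`:
complementary subspaces `V₁, V₂` of `H¹(A)` («`H¹(X) ⊕ H¹(X′)`»), `H^{0,1}(A) = L₁ ⊕ L₂` with `Lᵢ ⊆ Vᵢ`, adapted bases `bVᵢ` of `Vᵢ`
indexed by `Fin (nᵢ + nᵢ)` whose first halves span `Lᵢ` inside `Vᵢ`, and the class identity
`totalExteriorClass A κ = (Ecl bV₁ q₁ n₁) ∧ (Ecl bV₂ q₂ n₂)` («`ch(F ⊠ F′) = pr₁^* v(q₁) ∧ pr₂^* v(q₂)`» read in `Λ H¹`; `Ecl bV q n =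
Σ_m q_m h^m/m!` in divided-power form for the adapted `h = Σ_a ℓ_a ∧ m_a`).  The tree has no product-of-abelian-varieties Künneth
theorem, so nothing here DERIVES this shape for an explicit `X × X′`; a consumer supplies it.  Instances: the point-pair box
(`q = (a, 0, …, 0, b)`, `ρ₁ = ρ₂ = 2`: `6n² - 2n`, p4 gen 2), the theta-secant box (`q_m = a·[m = 0] + b`, seat p6), K-secant
boxes `A e^{λh} + B e^{μh}`.  Nothing here is a claim about any explicit variety; nothing here says that HC / HC_CM / HC_AV holds.
Everything PROVED; no named fact.
-/

noncomputable section

open Module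
open Literature.AlgebraicGeometry.Motives Literature.AlgebraicGeometry.HodgeTheory

namespace Summit.Ventures.HSemireg

namespace WedgeBridge

variable {K : Type*} [Field K] {n : ℕ} {V : Type*} [AddCommGroup V] [Module K V] (bV : Basis (Fin (n + n)) K V)

/-- **W-degree independence for EVERY h-part class:** `span(Ecl q n)` (even degrees `≥ 2`), `span₁(Ecl q n)` (odd) and the line
`K·Ecl q n` are independent — the bridge's `iSupIndep_spans_of_injective` at `g = gw q n ∈ Λⁿ W`.
[cite: BourbakiAlgebre1a3, Ch. III §11 no. 9] -/
theorem iSupIndep_spans_Ecl (q : ℕ → K) :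
    iSupIndep ![Summit.Ventures.HSemireg.ContractionSpan.span (Lsp bV : Set V) {θ : Module.Dual K V | ∀ v ∈ Lsp bV, θ v = 0}
        (Ecl bV q n),
      Summit.Ventures.HSemireg.ContractionSpan.span₁ (Lsp bV : Set V) {θ : Module.Dual K V | ∀ v ∈ Lsp bV, θ v = 0}
        (Ecl bV q n),
      K ∙ Ecl bV q n] := by
  rw [← Φ_gw]
  exact iSupIndep_spans_of_injective _ (Φ_vacuum_injective bV) (gw_mem bV n q)

/-- the h-part classes are EVEN (`Ecl q k ∈ evenFactorAlg ⊤`). [cite: BourbakiAlgebre1a3, Ch. III §7 no. 1] -/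
theorem Ecl_mem_evenFactorAlg : ∀ (k : ℕ) (q : ℕ → K),
    Ecl bV q k ∈ Summit.Ventures.HSemireg.ContractionSpan.evenFactorAlg (K := K) (⊤ : Submodule K V)
  | 0, q => by rw [Ecl]; exact Subalgebra.algebraMap_mem _ _
  | k + 1, q => by
    rw [Ecl]
    exact Subalgebra.add_mem _ (Ecl_mem_evenFactorAlg k q) (Subalgebra.mul_mem _ (LM_mem bV k) (Ecl_mem_evenFactorAlg k _))

/-- `dim span₁(Ecl q n) = n · rank H₁(q)` for the tree's degree-one contraction span (THEOREM H in degree `1` on the carrier).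
[cite: BuchweitzFlenner2008HH, Prop. 6.4.4] -/
theorem finrank_span₁_Ecl_eq_hankel (q : ℕ → K) :
    Module.finrank K (Summit.Ventures.HSemireg.ContractionSpan.span₁ (Lsp bV : Set V)
        ((Lsp bV).dualAnnihilator : Set (Module.Dual K V)) (Ecl bV q n)) =
      n * (Wedge.Hankel.hankel1 K n 1 q).rank := by
  rw [← S_one_eq, WedgeC15.finrank_S_Ecl_eq_hankel, Nat.choose_one_right]

end WedgeBridge

variable {A : AbelianVariety ℂ} {V₁ V₂ L₁ L₂ : Submodule ℂ (complexBetti A.X 1)}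

/-- **K∘T∘H on the real carriers.** If `H¹(A) = V₁ ⊕ V₂`, `H^{0,1}(A) = L₁ ⊕ L₂` with `Lᵢ ⊆ Vᵢ`, `bVᵢ` are adapted bases of
`Vᵢ` (indexed by `Fin (nᵢ + nᵢ)`, first halves spanning `Lᵢ` inside `Vᵢ`), and the total class of `κ` in `Λ H¹(A)` is the product
of two NON-ZERO h-part classes `Ecl bV₁ q₁ n₁ ∧ Ecl bV₂ q₂ n₂`, then
`contractionRank A κ = C(n₁,2)·ρ₂(q₁) + n₁ρ₁(q₁) · n₂ρ₁(q₂) + C(n₂,2)·ρ₂(q₂)`, `ρ_k(q) = rank H_k(q) = rank (q_{i+s})_{i ≤ k, s ≤ n-k}`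
(th-7's `[t²](P_{q₁} · P_{q₂})`). [cite: BuchweitzFlenner2008HH, Prop. 6.4.4] [cite: MumfordAV1970, §1 (4) and §4 (iii)] -/
theorem contractionRank_hankelBox (hA : IsSmoothProjective A.dim A.X) (κ : ∀ p : ℕ, complexBetti A.X (2 * p))
    (hV : IsCompl V₁ V₂) (hL : hodgeZeroOne hA = L₁ ⊔ L₂) (hL₁ : L₁ ≤ V₁) (hL₂ : L₂ ≤ V₂) {n₁ n₂ : ℕ}
    (bV₁ : Basis (Fin (n₁ + n₁)) ℂ V₁) (hb₁ : WedgeBridge.Lsp bV₁ = L₁.comap V₁.subtype)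
    (bV₂ : Basis (Fin (n₂ + n₂)) ℂ V₂) (hb₂ : WedgeBridge.Lsp bV₂ = L₂.comap V₂.subtype)
    (q₁ q₂ : ℕ → ℂ) (h₁0 : WedgeBridge.Ecl bV₁ q₁ n₁ ≠ 0) (h₂0 : WedgeBridge.Ecl bV₂ q₂ n₂ ≠ 0)
    (hx : totalExteriorClass A κ =
      ExteriorAlgebra.map V₁.subtype (WedgeBridge.Ecl bV₁ q₁ n₁) *
        ExteriorAlgebra.map V₂.subtype (WedgeBridge.Ecl bV₂ q₂ n₂)) :
    contractionRank A κ =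
      ((n₁.choose 2 * (Wedge.Hankel.hankel1 ℂ n₁ 2 q₁).rank +
          n₁ * (Wedge.Hankel.hankel1 ℂ n₁ 1 q₁).rank * (n₂ * (Wedge.Hankel.hankel1 ℂ n₂ 1 q₂).rank) +
          n₂.choose 2 * (Wedge.Hankel.hankel1 ℂ n₂ 2 q₂).rank : ℕ) : Cardinal) := by
  have hi₁ := WedgeBridge.iSupIndep_spans_Ecl bV₁ q₁
  have hi₂ := WedgeBridge.iSupIndep_spans_Ecl bV₂ q₂
  rw [hb₁] at hi₁
  rw [hb₂] at hi₂
  rw [contractionRank_box hA κ hV hL hL₁ hL₂ (WedgeBridge.Ecl_mem_evenFactorAlg bV₁ n₁ q₁)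
    (WedgeBridge.Ecl_mem_evenFactorAlg bV₂ n₂ q₂) hi₁ hi₂ hx]
  rw [← hb₁, ← hb₂, ← ContractionSpan.coe_dualAnnihilator_eq, ← ContractionSpan.coe_dualAnnihilator_eq,
    WedgeC15.finrank_contractionSpan_Ecl_eq_hankel, WedgeC15.finrank_contractionSpan_Ecl_eq_hankel,
    WedgeBridge.finrank_span₁_Ecl_eq_hankel, WedgeBridge.finrank_span₁_Ecl_eq_hankel, finrank_span_singleton h₁0,
    finrank_span_singleton h₂0, mul_one, one_mul]

end Summit.Ventures.HSemireg

end
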